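import Summits.FinalStateConjecture.FinalStateConjecture.Theorems.ExactKerrEndsTameEscapeToKerrEndsChartKerrEnd
import Literature.Geometry.Lorentzian.KerrBoyerLindquistAdmissible
import Literature.Geometry.Lorentzian.KerrBoyerLindquistConstraints
import Literature.Geometry.Lorentzian.SecondFundamentalFormOpensInclusion
import HarnessLib

/-!
# Route `ExactKerrEnds`, crux `TameEscapeToKerrEnds` (stmt-FinalStateConjecture-18522), line
# `matched-kerr-solution-map`: the rest-frame Kerr target of the gluing, GENERAL SPIN

Sequel of `ExactKerrEndsTameEscapeToKerrEndsSchwarzschildRestEnd.lean` (the case `a = 0`). The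
unit-scale analytic stub `S1♭♭` of the line asks the glued datum to be, far out, an EXACT spacelike
Kerr leaf and Dafermos–Rodnianski flat on the same end chart; the charges `J, C` of an admissible
datum are `o(R)` but not zero, so the matched far member is a Kerr slice with `a ≠ 0` AT REST. That
template now exists in the tree for every spin: the Boyer–Lindquist slice of Kerr in the
quasi-isotropic Cartesian coordinates of Brandt–Seidel (`Literature/…/KerrBoyerLindquist*.lean`):
the datum `Kerr.BL.blData hM hρ₁` on `Kerr.slice 0 ρ₁` (`h = blHRepCLM`, `k = kRepCLM`) is an exact
Kerr leaf everywhere (`Kerr.BL.isExactKerrEndAlong_blData`), Dafermos–Rodnianski flat with mass `M`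
on its inclusion end `Kerr.BL.blEnd ρ₁` (`Kerr.BL.isStronglyAsymptoticallyFlatDR_blData`, ADM energy
`M`, momentum `0`) and solves the vacuum constraints (`Kerr.BL.isVacuumConstraintSolution_blData`,
Gauss–Codazzi with `Kerr.ricci_smoothMetric`).

This file states the consequences in the form the gluing construction consumes:

* `chartKerrBLBeyond_isChartExactKerrBeyond` — if, beyond chart radius `ρ ≥ max ρ₁ 0` on an end
  `e`, the chart components of a datum `D` ARE the Boyer–Lindquist Kerr data
  (`hCoeff e D y = blHRepCLM M a y`, `kCoeff e D y = kRepCLM M a y` for `ρ < ‖y‖`), then `D` is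
  chart-exact Kerr beyond `ρ` (the unfolded `IsChartExactKerrBeyond e D ρ`, witnesses
  `(M, a, 0, leaf ∘ j, normal ∘ j)` over `exteriorRegion ρ`, `j` the inclusion into the slice);
* `hasExactKerrEnd_of_chartKerrBLBeyond` — hence, on a sole end with `e.R ≤ ρ`, `D` is Kerr-ended;
* `kerrBLRestTemplate` — the template itself: `Kerr.BL.blData` is chart-exact Kerr beyond
  `max ρ₁ 0 + 1` on `Kerr.BL.blEnd ρ₁`, DR-flat there with mass `M`, and vacuum.

What remains for the item is unchanged: `S1♭♭` (elliptic, unprinted as typed), the two positive-mass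
named facts, and the bend-to-rest interpolation inside exact Kerr.
-/

set_option linter.dupNamespace false

noncomputable section

namespace Summit.FinalStateConjecture.FinalStateConjecture.Theorems.ExactKerrEnds

open scoped Manifold ContDiff InnerProductSpace
open Set Function TopologicalSpace Topology Literature.Geometry.Lorentzian

variable {X : Type} [TopologicalSpace X] [ChartedSpace E3 X] [IsManifold (𝓡 3) ∞ X]

/-- Beyond `max ρ₁ 0 ≤ ρ < ‖y‖` the point `y` lies in `Kerr.slice 0 ρ₁`. [folklore] -/
theorem mem_kerrSlice_of_lt {ρ₁ ρ : ℝ} (hρ : max ρ₁ 0 ≤ ρ) {y : E3} (hy : ρ < ‖y‖) :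
    y ∈ Kerr.slice 0 ρ₁ :=
  Kerr.mem_slice_zero_iff.2 (hρ.trans_lt hy)

/-- **Boyer–Lindquist Kerr in the chart ⇒ chart-exact Kerr beyond `ρ`, general spin.** Let `e` be an
end of `X`, `D` a datum, `0 ≤ M`, `ρH(M, a) ≤ ρ₁`, `max ρ₁ 0 ≤ ρ`. If for every `y` with `ρ < ‖y‖`
the chart components of `D` are the Boyer–Lindquist Kerr data, `hCoeff e D y = blHRepCLM M a y`,
`kCoeff e D y = kRepCLM M a y`, then the unfolded `IsChartExactKerrBeyond e D ρ` of line
`matched-kerr-solution-map` holds, with Kerr parameters `(M, a, 0)`, leaf `Kerr.BL.leaf ∘ j`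
(`j : exteriorRegion ρ → Kerr.slice 0 ρ₁` the inclusion) and normal `Kerr.BL.normal ∘ j`
(`bilin_mfderiv_leaf`, `secondFundamentalForm_leaf`, transported along `j` by
`secondFundamentalForm_comp_opensInclusion`). Brandt–Seidel 1996, §II; Corvino–Schoen 2006, §1 and
Thm. 4. [cite: CorvinoSchoen2006, §1 and Thm. 4] -/
theorem chartKerrBLBeyond_isChartExactKerrBeyond :
    ∀ {X : Type} [TopologicalSpace X] [ChartedSpace E3 X] [IsManifold (𝓡 3) ∞ X] [Kerr.Facts]
      (e : AFEnd X) (D : InitialDataSet (𝓡 3) X) {M a ρ₁ ρ : ℝ} (hM : 0 ≤ M)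
      (hρ₁ : Kerr.BL.rhoH M a ≤ ρ₁), max ρ₁ 0 ≤ ρ →
      (∀ y : E3, ρ < ‖y‖ → AFEnd.hCoeff e D y = Kerr.Ingoing.blHRepCLM M a y) →
      (∀ y : E3, ρ < ‖y‖ → AFEnd.kCoeff e D y = Kerr.BL.kRepCLM M a y) →
      ∃ (M' a' r₀ : ℝ) (hM' : 0 ≤ M') (ψ : exteriorRegion ρ → Kerr.region a' r₀)
        (ν : NormalField 𝓘(ℝ, E4) ψ),
        Function.Injective ψ ∧
        (Kerr.smoothMetric M' a' r₀).IsSpacelikeImmersion 𝓘(ℝ, E3) ψ ∧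
        (Kerr.smoothMetric M' a' r₀).IsFutureUnitNormal 𝓘(ℝ, E3)
          ((Kerr.timeOrientation M' a' r₀ hM').ofLE le_top) ψ ν ∧
        (∀ (y : exteriorRegion ρ) (v w : E3),
          AFEnd.hCoeff e D (y : E3) v w =
            Kerr.bilin M' a' (ψ y : E4) (mfderiv 𝓘(ℝ, E3) 𝓘(ℝ, E4) ψ y v)
              (mfderiv 𝓘(ℝ, E3) 𝓘(ℝ, E4) ψ y w)) ∧
        (∀ [(Kerr.smoothMetric M' a' r₀).HasLeviCivita] (y : exteriorRegion ρ) (v w : E3),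
          AFEnd.kCoeff e D (y : E3) v w =
            (Kerr.smoothMetric M' a' r₀).secondFundamentalForm 𝓘(ℝ, E3) ψ ν y v w) := by
  intro X _ _ _ _ e D M a ρ₁ ρ hM hρ₁ hρ hh hk
  have hb : Kerr.BL.rH M a < Kerr.BL.rH M a + 1 := by linarith
  set j : exteriorRegion ρ → Kerr.slice 0 ρ₁ :=
    fun y ↦ ⟨y, mem_kerrSlice_of_lt hρ (mem_exteriorRegion.1 y.2)⟩ with hj_def
  have hj : ∀ y : exteriorRegion ρ, ((j y : Kerr.slice 0 ρ₁) : E3) = y := fun _ ↦ rfl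
  set L := Kerr.BL.leaf M a (Kerr.BL.rH M a + 1) ρ₁ hM hρ₁ with hL
  set N := Kerr.BL.normal M a (Kerr.BL.rH M a + 1) ρ₁ hM hρ₁ with hN
  have hLs := Kerr.BL.isSpacelikeImmersion_leaf (b := Kerr.BL.rH M a + 1) hM hρ₁ hb
  have hLn := Kerr.BL.isFutureUnitNormal_normal (b := Kerr.BL.rH M a + 1) hM hρ₁ hb
  have hd : ∀ y : exteriorRegion ρ, MDifferentiableAt 𝓘(ℝ, E3) 𝓘(ℝ, E4) L (j y) := fun y ↦
    (Kerr.BL.contMDiff_leaf hM hρ₁ hb (j y)).mdifferentiableAt (by simp)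
  have hmf : ∀ (y : exteriorRegion ρ) (v : E3),
      mfderiv 𝓘(ℝ, E3) 𝓘(ℝ, E4) (L ∘ j) y v = mfderiv 𝓘(ℝ, E3) 𝓘(ℝ, E4) L (j y) v := fun y v ↦
    PseudoRiemannianMetric.mfderiv_comp_opensInclusion j hj (hd y) v
  refine ⟨M, a, 0, hM, L ∘ j, fun y ↦ N (j y), ?_, ⟨?_, fun y v hv ↦ ?_⟩,
    ⟨⟨fun y v ↦ ?_, fun y ↦ hLn.1.2 (j y)⟩, fun y ↦ hLn.2 (j y)⟩, fun y v w ↦ ?_, fun y v w ↦ ?_⟩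
  · -- injective
    intro y₁ y₂ h
    have h' : j y₁ = j y₂ := Kerr.BL.leaf_injective hM hρ₁ h
    exact Subtype.ext (congrArg (fun p : Kerr.slice 0 ρ₁ ↦ (p : E3)) h')
  · -- smooth
    exact (Kerr.BL.contMDiff_leaf hM hρ₁ hb).comp (OpensChart.contMDiff_of_coe_eq j hj)
  · -- spacelike
    have h := hLs.inducedBilin_pos (j y) hv
    rw [PseudoRiemannianMetric.inducedBilin_apply, Kerr.smoothMetric_val] at h ⊢
    rw [hmf y v]
    exact h
  · -- normal
    rw [hmf y]
    exact hLn.1.1 (j y) v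
  · -- the metric clause
    rw [hh y y.2, hmf y, hmf y, Function.comp_apply, Kerr.BL.bilin_mfderiv_leaf hM hρ₁ hb (j y) v w,
      Kerr.Ingoing.blHRepCLM_apply]
  · -- the `k` clause
    have hK := PseudoRiemannianMetric.secondFundamentalForm_comp_opensInclusion
      (Kerr.smoothMetric M a 0).toPseudoRiemannianMetric j hj L N y (hd y)
    rw [hk y y.2, hK]
    exact (Kerr.BL.secondFundamentalForm_leaf hM hρ₁ hb (j y) v w).symm

/-- **A datum which is Boyer–Lindquist Kerr in the chart of a sole end is Kerr-ended** (general
spin). On a sole asymptotically flat end `e` of `X` with `e.R ≤ ρ`, `max ρ₁ 0 ≤ ρ`, `ρH ≤ ρ₁`,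
`0 ≤ M`: if beyond `ρ` the chart components of `D` are `blHRepCLM M a` and `kRepCLM M a`, then
`D.HasExactKerrEnd` (via the landed stub S3a `chartKerrEnd`). This is the rest-frame
(`P_ADM = 0`, Dafermos–Rodnianski-admissible) Kerr target of an exterior gluing with spin.
Corvino–Schoen 2006, Thm. 4; Brandt–Seidel 1996, §II. [cite: CorvinoSchoen2006, §1 and Thm. 4] -/
theorem hasExactKerrEnd_of_chartKerrBLBeyond [T2Space X] [SecondCountableTopology X]
    [ConnectedSpace X] (e : AFEnd X) (D : InitialDataSet (𝓡 3) X) {M a ρ₁ ρ : ℝ} (hM : 0 ≤ M)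
    (hρ₁ : Kerr.BL.rhoH M a ≤ ρ₁) (hρ : max ρ₁ 0 ≤ ρ) (hsole : e.IsSoleEnd) (hRρ : e.R ≤ ρ)
    (hh : ∀ y : E3, ρ < ‖y‖ → AFEnd.hCoeff e D y = Kerr.Ingoing.blHRepCLM M a y)
    (hk : ∀ y : E3, ρ < ‖y‖ → AFEnd.kCoeff e D y = Kerr.BL.kRepCLM M a y) :
    D.HasExactKerrEnd := by
  intro hKF
  exact chartKerrEnd X e D ρ hsole hRρ (chartKerrBLBeyond_isChartExactKerrBeyond e D hM hρ₁ hρ hh hk)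

/-- **The rest-frame Kerr template of arbitrary spin** (`KerrRestLeafDR`, general `a`): for
`0 ≤ M`, any `a` and `ρ₁ ≥ ρH(M, a)`, the Boyer–Lindquist Kerr datum `Kerr.BL.blData hM hρ₁` on
`Kerr.slice 0 ρ₁` is chart-exact Kerr beyond `max ρ₁ 0 + 1` on its inclusion end `Kerr.BL.blEnd ρ₁`,
Dafermos–Rodnianski flat there with mass parameter `M` (so `E_ADM = M`, `P_ADM = 0`), and solves the
vacuum constraint equations. Brandt–Seidel 1996, §II; Dafermos–Rodnianski 2013, App. B.2.3;
Choquet-Bruhat 2009, Ch. VI, Thm. 3.3. [cite: BrandtSeidel1996, §II] -/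
theorem kerrBLRestTemplate [Kerr.Facts] {M a ρ₁ : ℝ} (hM : 0 ≤ M) (hρ₁ : Kerr.BL.rhoH M a ≤ ρ₁) :
    (∃ (M' a' r₀ : ℝ) (hM' : 0 ≤ M')
        (ψ : exteriorRegion (max ρ₁ 0 + 1) → Kerr.region a' r₀) (ν : NormalField 𝓘(ℝ, E4) ψ),
        Function.Injective ψ ∧
        (Kerr.smoothMetric M' a' r₀).IsSpacelikeImmersion 𝓘(ℝ, E3) ψ ∧
        (Kerr.smoothMetric M' a' r₀).IsFutureUnitNormal 𝓘(ℝ, E3)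
          ((Kerr.timeOrientation M' a' r₀ hM').ofLE le_top) ψ ν ∧
        (∀ (y : exteriorRegion (max ρ₁ 0 + 1)) (v w : E3),
          AFEnd.hCoeff (Kerr.BL.blEnd ρ₁) (Kerr.BL.blData hM hρ₁) (y : E3) v w =
            Kerr.bilin M' a' (ψ y : E4) (mfderiv 𝓘(ℝ, E3) 𝓘(ℝ, E4) ψ y v)
              (mfderiv 𝓘(ℝ, E3) 𝓘(ℝ, E4) ψ y w)) ∧
        (∀ [(Kerr.smoothMetric M' a' r₀).HasLeviCivita] (y : exteriorRegion (max ρ₁ 0 + 1))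
          (v w : E3),
          AFEnd.kCoeff (Kerr.BL.blEnd ρ₁) (Kerr.BL.blData hM hρ₁) (y : E3) v w =
            (Kerr.smoothMetric M' a' r₀).secondFundamentalForm 𝓘(ℝ, E3) ψ ν y v w)) ∧
      (Kerr.BL.blEnd ρ₁).IsStronglyAsymptoticallyFlatDR (Kerr.BL.blData hM hρ₁) M ∧
      (Kerr.BL.blEnd ρ₁).admEnergy (Kerr.BL.blData hM hρ₁) = M ∧
      (∀ i : Fin 3, (Kerr.BL.blEnd ρ₁).admMomentum (Kerr.BL.blData hM hρ₁) i = 0) ∧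
      (∀ [(Kerr.smoothMetric M a 0).HasLeviCivita] [(Kerr.BL.blData hM hρ₁).metric.HasLeviCivita],
        (Kerr.BL.blData hM hρ₁).IsVacuumConstraintSolution) :=
  ⟨chartKerrBLBeyond_isChartExactKerrBeyond (Kerr.BL.blEnd ρ₁) (Kerr.BL.blData hM hρ₁) hM hρ₁
      (by linarith [le_max_right ρ₁ 0]) (fun y hy ↦ Kerr.BL.hCoeff_blEnd_eq hM hρ₁ hy)
      (fun y hy ↦ Kerr.BL.kCoeff_blEnd_eq hM hρ₁ hy),
    Kerr.BL.isStronglyAsymptoticallyFlatDR_blData hM hρ₁, Kerr.BL.admEnergy_blData hM hρ₁,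
    Kerr.BL.admMomentum_blData hM hρ₁, Kerr.BL.isVacuumConstraintSolution_blData hM hρ₁⟩

end Summit.FinalStateConjecture.FinalStateConjecture.Theorems.ExactKerrEnds

end
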